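import Summits.CriticalPhenomena.SAWScalingLimit.Theorems.SAWDevelopingMapHexConjectureRestrictionCocycleOfAspectBound
import Summits.CriticalPhenomena.SAWScalingLimit.Theorems.SAWDevelopingMapHexConjectureAspectBoundOfWindowTwoPoint
import Summits.CriticalPhenomena.SAWScalingLimit.Theorems.HexConjecture.Negative.NonVacuity
import Summits.CriticalPhenomena.SAWScalingLimit.Theses.SAWDevelopingMap
import Summits.CriticalPhenomena.SAWScalingLimit.Theses.SAWHexUniversality
import Summits.CriticalPhenomena.SAWScalingLimit.Theses.SAWBrickWallHomotopy
import Literature.Probability.RandomPlanarGeometry.HexSAWTriangle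
import HarnessLib

/-!
# Line `one-domain-side-floor-profile` — crux `HexConjecture` (stmt-CriticalPhenomena-0808)
ALTERNATIVE line (crux-strategist s2, 2026-08-17).  It does NOT replace the live skeleton `Lines/root_locality_replaces_loewner.lean`
of the lead; it reuses that line's layer-1 composition verbatim and re-sources its lever.

THE CRUX (fixed): Duminil-Copin–Smirnov 2012 Conjecture 1 on the honeycomb lattice, as typed in the route files
(`SAWDevelopingMap.HexConjecture` = `SAWHexUniversality.HexConjecture` = `SAWBrickWallHomotopy.HexConjecture`, identical bodies).

WHERE THE LIVE LINE IS STUCK (lead seats c8–c11).  `HexConjecture ⟸ FloorRatioLimit ∧ WindowTwoPointLowerBound ∧ UniformModulus ∧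
BoundaryUniversality` is kernel-checked (landed glue p118046 / p126051 / p129016 / p142668).  The line's own piece, the lever WTLB
("cube ↦ linear": `triDl ⌊R/4⌋ ≤ C · Σ_{d ∈ [θa R, θb R]} Z_{B_R(x)}(s_x → t_{x+d})`), is attacked on the T-side:
`WTLB ⟸ TriDlLowerRegular (REG) ⟸ TriDlDoubling` (Krachun–Panagiotis 2023 §3 in confined form, 19 landed files).
STUCK GOAL (verbatim, `stub_triDlLowerRegular`):
`∃ C : ℝ, ∀ T : ℕ, 1 ≤ T → ∑ i ∈ Finset.range (T + 1), HV.triDl i ≤ C * ((T : ℝ) + 1) * HV.triDl T`.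
Seat c10's verdict: with the parafermionic identities (exact accounting of TOTAL mass by exit class), one-sided domain monotonicity
and gluing (polynomial losses) "a LINEAR comparison between masses of two geometric classes at one scale is never produced";
REG / doubling is an RSW/FKG-substitute for the critical hexagonal walk; KP §3 is sharp in every exponent.  Strategist s2's
census (this dir) adds: REG is not forced by any proved single-sequence constraint (Kaluza cliff family), and its bridge form is an
SRT lower bound with no tool.

THE MOVE OF THIS LINE.  Do not ask the T-side for the linear comparison.  Feed the SAME lever WTLB from the OBSERVABLE side,
inside ONE domain with ONE root, where the unknown normalisation of the critical boundary two-point function CANCELS: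

* `SideFloorComparison` (SFB, the NEW LEVER, `stub_sideFloorComparison`): in the lattice equilateral triangle `T_L`
  (`HV.triV L` — Glazman–Manolescu's / Krachun–Panagiotis's triangle, root = the base mid-edge `a`), the `x_c`-mass of the walks from
  `a` to the LEFT SIDE (`HV.triDl L`) is at most `C ×` the `x_c`-mass of the walks from `a` to the FLOOR WINDOW of offsets `d ∈ [L/4, L/2]`
  of the SAME triangle, for all large `L`.  Both functionals are boundary exit masses of ONE critical SAW ensemble from ONE root in ONE
  fixed lattice polygon.  Under Duminil-Copin–Smirnov's Conjecture 2 read on the CLOSED lattice sides of that polygon (the route's target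
  stmt-14003 is its horizontal-floor, two-pinned-points instance) both are `λ_L · L · (continuum profile integral) · (1 + o(1))` with the
  SAME scalar `λ_L = Z_{T_L}(a → t_{⌊L/3⌋})`, and the ratio tends to `I_side / I_window ∈ (0, ∞)` (boundary exponent `5/8`; the side
  profile `|Ψ'|^{5/8}` vanishes like `s^{5/4}` at the two `60°` corners of the side, so it is integrable up to them).  No second domain, no
  second scale, no regularity of the sequence `L ↦ triDl L`, no renewal structure.
* `stub_windowTwoPoint_of_sideFloorComparison` (GLUE, size M): SFB ⟹ WTLB by MONOTONICITY in the favourable direction — the triangle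
  `T_{⌊R/4⌋}` rooted at `s_x` lies inside the half-box `B_R(x)` (all its cells are within distance `< R/2` of the root), so every floor
  arrival of the triangle at offset `d` is, through the chart of the lead's landed `…TriangleChart` / `…WindowMassCube` files, a walk of
  `HexMidEdgeSAW (B_R x) s_x t_{x+d}` of the same length; and `[L/4, L/2]`, `L = ⌊R/4⌋`, lies inside `[R/20, R/8]` for `R ≥ 20`:
  take `θa = 1/20`, `θb = 1/8`, the same `C`, `R₀ = max (4 L₀ + 4) 20`.
* the other three stubs are the lead's / the strategist split's children VERBATIM: `stub_floorRatioLimit` (⟸ target 14003 by the landed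
  transport), `stub_uniformModulus`, `stub_boundaryUniversality` (both necessary: p79732, `boundaryUniversality_of_hexConjecture`).

Compositions (kernel-checked, sorry-free): `HexConjecture_of : FRL → SFB → (SFB → WTLB) → UIM → (E) → SAWDevelopingMap.HexConjecture`;
`HexConjecture_of_windowTwoPoint` (layer 1 = the landed `Split.HexConjecture_of_subs`, re-derived from its two built imports because the check
farm has not yet built `…Split`); primed versions for the `SAWHexUniversality` / `SAWBrickWallHomotopy` decls (identical bodies).

WHY IT DODGES THE STUCK GOAL.  REG / doubling are statements about the sequence `L ↦ triDl L` ACROSS SCALES; their only known source is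
an `O(1)`-cost extension of escaping walks (the missing FKG/RSW gluing, c10 §2.6), and the s2 census shows no proved property of the
sequence forces them.  SFB compares two exit functionals AT ONE SCALE IN ONE DOMAIN; its intended source is a LIMIT THEOREM for the
normalised parafermionic observable on the closed boundary of a lattice polygon — a tool outside c10's list {identities, monotonicity,
gluing} — and the one place where a linear one-scale comparison comes for free: two Riemann sums of boundary values of the SAME discrete
function against ONE normaliser.  In the solved sibling (Ising / FK-Ising fermionic observables) the boundary values on whole polygonal
sides, corners included, are controlled by discrete complex analysis alone (Chelkak–Smirnov arXiv:0910.2045 §§3–5; Chelkak arXiv:1212.6205),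
never by RSW.

BARRIERS.  `Literature.Barriers.CriticalPhenomena.ParafermionicHalfCauchyRiemann`: it DOES bite the intended proof of SFB (boundary
convergence of the parafermion needs the missing half of discrete CR) — exactly as it bites the route target 14003 and the child FRL; the bet
of this line is that the crux then has ONE analytic atom (the observable programme: route cruxes NoFoldBound 8296 / InteriorFlattening 8297 /
QCIdentification 8298 ⟹ 14003, asked here for the closed lattice sides of one polygon as well) plus the two NECESSARY regularity atoms
UIM, (E) — and NO independent RSW-type atom.  `NienhuisWeightsExcludeVertexSAW`, `EmbeddingModulusUniqueness`: not in play (hexagonal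
lattice only; no universality transfer inside this crux).

DISPROOF USED (`Cruxes/HexConjecture/Disproof.lean`, gen 3, verdict RESISTS): `Negative.hexConjecture_false_without_tendsto_fst / _snd /
_reachable` honoured — `stub_uniformModulus` and `stub_boundaryUniversality` carry `IsEmbEndpointApprox` in full and the floor bootstrap consumes
`tendsto_fst/snd` (orientation of the limit arc) and `reachable` (laws are probability measures eventually); refuted strengthenings (all-`δ`
probability, fugacity `0`, stmt-0772 all-`δ` tightness, stmt-5420 corridor root): no stub is an instance — every law statement is eventual
and at `x_c`, FRL pins exact half-lattice rows at the three points, SFB has no domain freedom at all (one explicit lattice triangle).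
Negatives index (11 entries, 2026-08-17): none is a stub of this line.
-/

noncomputable section

namespace Summit.CriticalPhenomena.SAWScalingLimit.Cruxes.HexConjecture.OneDomainSideFloorProfile

open scoped Topology NNReal ENNReal BigOperators
open Filter Set Metric MeasureTheory
open Literature.Probability.LatticeModels (HexVertex hexGraph hexCenter)
open Literature.Probability.RandomPlanarGeometry
open Literature.Probability.RandomPlanarGeometry.SAW

/-! ## The five statements of the line (named Props; the registered stubs below restate them fully qualified) -/

/-- STATEMENT 1 — `FloorRatioLimit` (FRL; child 1 of the strategist split, verbatim the lead's `stub_floorRatioLimit`;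
⟸ target stmt-14003 by the landed transport `RootLocality.floorRatioModulus_of_hexObservableLimit`). -/
def FloorRatioLimit : Prop :=
  ∀ (D D' : Literature.Probability.RandomPlanarGeometry.DobrushinDomain) (ρ : ℝ) (Λ : ℝ → Finset Literature.Probability.LatticeModels.HexVertex) (m₀ m m' : ℝ → ℤ) (a b b' : ℝ → Sym2 Literature.Probability.LatticeModels.HexVertex) (Φ : Literature.Probability.RandomPlanarGeometry.ConformalEquiv D.carrier UpperHalfPlane.upperHalfPlaneSet) (L : ℂ → ℂ) (Lb Lb' : ℂ), D'.carrier = D.carrier → D'.pt 0 = D.pt 0 → 0 < ρ → D.carrier ∩ Metric.ball (D.pt 0) ρ = {z : ℂ | (D.pt 0).im < z.im} ∩ Metric.ball (D.pt 0) ρ → D.carrier ∩ Metric.ball (D.pt 1) ρ = {z : ℂ | (D.pt 1).im < z.im} ∩ Metric.ball (D.pt 1) ρ → D.carrier ∩ Metric.ball (D'.pt 1) ρ = {z : ℂ | (D'.pt 1).im < z.im} ∩ Metric.ball (D'.pt 1) ρ → (∀ᶠ δ : ℝ in nhdsWithin (0 : ℝ) (Set.Ioi 0), Literature.Probability.RandomPlanarGeometry.SAW.hexDomainSimplyConnected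 (Λ δ) ∧ a δ ∈ Literature.Probability.RandomPlanarGeometry.SAW.hexDomainBoundary (Λ δ) ∧ b δ ∈ Literature.Probability.RandomPlanarGeometry.SAW.hexDomainBoundary (Λ δ) ∧ b' δ ∈ Literature.Probability.RandomPlanarGeometry.SAW.hexDomainBoundary (Λ δ) ∧ Nonempty (Literature.Probability.RandomPlanarGeometry.SAW.HexMidEdgeSAW (Λ δ) (a δ) (b δ)) ∧ Nonempty (Literature.Probability.RandomPlanarGeometry.SAW.HexMidEdgeSAW (Λ δ) (a δ) (b' δ)) ∧ (Literature.Probability.LatticeModels.hexGraph.induce (↑(Λ δ) : Set Literature.Probability.LatticeModels.HexVertex)).Preconnected ∧ (∀ v ∈ Λ δ, (δ : ℂ) * Literature.Probability.LatticeModels.hexCenter v ∈ D.carrier) ∧ (∀ v : Literature.Probability.LatticeModels.HexVertex, (δ : ℂ) * Literature.Probability.LatticeModels.hexCenter v ∈ Metric.ball (D.pt 0) ρ → (v ∈ Λ δ ↔ m₀ δ ≤ v.1 1)) ∧ (∀ v : Literature.Probability.LatticeModels.HexVertex, (δ : ℂ) * Literature.Probability.LatticeModels.hexCenter v ∈ Metric.ball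 (D.pt 1) ρ → (v ∈ Λ δ ↔ m δ ≤ v.1 1)) ∧ (∀ v : Literature.Probability.LatticeModels.HexVertex, (δ : ℂ) * Literature.Probability.LatticeModels.hexCenter v ∈ Metric.ball (D'.pt 1) ρ → (v ∈ Λ δ ↔ m' δ ≤ v.1 1))) → (∀ K : Set ℂ, IsCompact K → K ⊆ D.carrier → ∀ᶠ δ : ℝ in nhdsWithin (0 : ℝ) (Set.Ioi 0), ∀ v : Literature.Probability.LatticeModels.HexVertex, (δ : ℂ) * Literature.Probability.LatticeModels.hexCenter v ∈ K → v ∈ Λ δ) → Filter.Tendsto (fun δ : ℝ => (δ : ℂ) * Literature.Probability.RandomPlanarGeometry.SAW.hexMidpoint (a δ)) (nhdsWithin (0 : ℝ) (Set.Ioi 0)) (nhds (D.pt 0)) → Filter.Tendsto (fun δ : ℝ => (δ : ℂ) * Literature.Probability.RandomPlanarGeometry.SAW.hexMidpoint (b δ)) (nhdsWithin (0 : ℝ) (Set.Ioi 0)) (nhds (D.pt 1)) → Filter.Tendsto (fun δ : ℝ => (δ : ℂ) * Literature.Probability.RandomPlanarGeometry.SAW.hexMidpoint (b' δ)) (nhdsWithin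 (0 : ℝ) (Set.Ioi 0)) (nhds (D'.pt 1)) → Filter.Tendsto (fun x => ‖Φ x‖) (nhdsWithin (D.pt 0) D.carrier) Filter.atTop → Φ.HasBoundaryValue (D.pt 1) 0 → ContinuousOn L D.carrier → (∀ z ∈ D.carrier, Complex.exp (L z) = deriv Φ z) → Filter.Tendsto L (nhdsWithin (D.pt 1) D.carrier) (nhds Lb) → Filter.Tendsto L (nhdsWithin (D'.pt 1) D.carrier) (nhds Lb') → Filter.Tendsto (fun δ : ℝ => ‖Literature.Probability.RandomPlanarGeometry.SAW.hexParafermionicObservable (Λ δ) (a δ) Literature.Probability.RandomPlanarGeometry.SAW.hexCriticalFugacity (5 / 8) (b' δ) / Literature.Probability.RandomPlanarGeometry.SAW.hexParafermionicObservable (Λ δ) (a δ) Literature.Probability.RandomPlanarGeometry.SAW.hexCriticalFugacity (5 / 8) (b δ)‖) (nhdsWithin (0 : ℝ) (Set.Ioi 0)) (nhds (Real.exp ((5 / 8) * (Lb' - Lb).re)))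

/-- STATEMENT 2 — `SideFloorComparison` (SFB; THE NEW LEVER of this line).  In the lattice triangle `T_L = HV.triV L` rooted at
the base mid-edge `a`: the `x_c`-mass of walks to the LEFT SIDE (`HV.triDl L`) is at most `C ×` the `x_c`-mass of walks to the FLOOR in the
window of offsets `d ∈ [L/4, L/2]` (final dart `(d,0,false) → (d,-1,true)`), eventually in `L`.  ONE domain, ONE root, ONE scale.
Predicted: ratio `→ I_side / I_window ∈ (0,∞)` (both sides `≍ L^{-1/4}`; boundary exponent `5/8`, the side profile `≍ s^{5/4}` at the two `60°`
corners is integrable up to them).  OPEN; implied by DCS Conjecture 2 read on the closed lattice sides of the triangle. -/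
def SideFloorComparison : Prop :=
  ∃ C : ℝ, ∃ L₀ : ℕ, ∀ L : ℕ, L₀ ≤ L → Literature.Probability.RandomPlanarGeometry.SAW.HV.triDl L ≤ C * ∑ d ∈ Finset.Icc ((L : ℤ) / 4) ((L : ℤ) / 2), ∑ P ∈ (Literature.Probability.RandomPlanarGeometry.SAW.HV.midWalks (Literature.Probability.RandomPlanarGeometry.SAW.HV.triV L)).filter (fun P => Literature.Probability.RandomPlanarGeometry.SAW.HV.finalDart P = ((d, 0, false), (d, -1, true)) ∨ Literature.Probability.RandomPlanarGeometry.SAW.HV.finalDart P = ((d, -1, true), (d, 0, false))), Literature.Probability.RandomPlanarGeometry.SAW.hexCriticalFugacity ^ Literature.Probability.RandomPlanarGeometry.SAW.HV.mwLen P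

/-- STATEMENT 3 — `WindowTwoPointLowerBound` (WTLB; the lead's lever since seat c8 = child 2 of the split, verbatim). -/
def WindowTwoPointLowerBound : Prop :=
  ∃ θa θb C : ℝ, 0 < θa ∧ θa < θb ∧ θb ≤ 1 / 4 ∧ 0 < C ∧ ∃ R₀ : ℝ, 0 < R₀ ∧ ∀ R : ℝ, R₀ ≤ R → ∀ (x : Literature.Probability.LatticeModels.Site 2) (B : Finset Literature.Probability.LatticeModels.HexVertex) (S' : Finset ℤ), (∀ v : Literature.Probability.LatticeModels.HexVertex, v ∈ B ↔ (x 1 ≤ v.1 1 ∧ dist (Literature.Probability.LatticeModels.hexCenter v) (Literature.Probability.RandomPlanarGeometry.SAW.hexMidpoint s((x - Pi.single 1 1, 1), (x, 0))) ≤ R)) → (∀ d : ℤ, d ∈ S' ↔ (θa * R ≤ (d : ℝ) ∧ (d : ℝ) ≤ θb * R)) → Literature.Probability.RandomPlanarGeometry.SAW.HV.triDl ⌊R / 4⌋₊ ≤ C * ∑ d ∈ S', ∑ γ : Literature.Probability.RandomPlanarGeometry.SAW.HexMidEdgeSAW B s((x - Pi.single 1 1, 1), (x, 0)) s((x + Pi.single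 0 d - Pi.single 1 1, 1), (x + Pi.single 0 d, 0)), Literature.Probability.RandomPlanarGeometry.SAW.hexCriticalFugacity ^ γ.length

/-- STATEMENT 4 — `UniformModulus` (UIM; child 3 of the split, verbatim; necessary, p79732). -/
def UniformModulus : Prop :=
  ∀ (D : Literature.Probability.RandomPlanarGeometry.DobrushinDomain) (ρ : ℝ) (a b : ℝ → Literature.Probability.LatticeModels.HexVertex), (0 < ρ ∧ (D.pt 1).im = (D.pt 0).im ∧ D.carrier ⊆ {z : ℂ | (D.pt 0).im < z.im} ∧ D.carrier ∩ Metric.ball (D.pt 0) ρ = {z : ℂ | (D.pt 0).im < z.im} ∩ Metric.ball (D.pt 0) ρ ∧ D.carrier ∩ Metric.ball (D.pt 1) ρ = {z : ℂ | (D.pt 1).im < z.im} ∩ Metric.ball (D.pt 1) ρ) → (Literature.Probability.RandomPlanarGeometry.SAW.IsEmbEndpointApprox Literature.Probability.LatticeModels.hexGraph Literature.Probability.LatticeModels.hexCenter D a b ∧ ∀ᶠ δ : ℝ in nhdsWithin (0 : ℝ) (Set.Ioi 0), (∃ u : Literature.Probability.LatticeModels.HexVertex, Literature.Probability.LatticeModels.hexGraph.Adj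 (a δ) u ∧ ((δ : ℂ) * Literature.Probability.LatticeModels.hexCenter u).im ≤ (D.pt 0).im) ∧ (∃ u : Literature.Probability.LatticeModels.HexVertex, Literature.Probability.LatticeModels.hexGraph.Adj (b δ) u ∧ ((δ : ℂ) * Literature.Probability.LatticeModels.hexCenter u).im ≤ (D.pt 1).im)) → ∀ ε η : ℝ, 0 < ε → 0 < η → ∃ θ : ℝ, 0 < θ ∧ ∀ᶠ δ : ℝ in nhdsWithin (0 : ℝ) (Set.Ioi 0), Literature.Probability.RandomPlanarGeometry.SAW.hexSAWLaw D.carrier δ (a δ) (b δ) {γ | γ.curve ∉ Literature.Probability.RandomPlanarGeometry.CurveClass.modulusClass ε θ} ≤ ENNReal.ofReal η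

/-- The floor-class convergence statement (crux-10472's class: floor domains, floor-vertex endpoints). -/
def FloorConvergence : Prop :=
  ∀ (D : Literature.Probability.RandomPlanarGeometry.DobrushinDomain) (ρ : ℝ) (a b : ℝ → Literature.Probability.LatticeModels.HexVertex), (0 < ρ ∧ (D.pt 1).im = (D.pt 0).im ∧ D.carrier ⊆ {z : ℂ | (D.pt 0).im < z.im} ∧ D.carrier ∩ Metric.ball (D.pt 0) ρ = {z : ℂ | (D.pt 0).im < z.im} ∩ Metric.ball (D.pt 0) ρ ∧ D.carrier ∩ Metric.ball (D.pt 1) ρ = {z : ℂ | (D.pt 1).im < z.im} ∩ Metric.ball (D.pt 1) ρ) → (Literature.Probability.RandomPlanarGeometry.SAW.IsEmbEndpointApprox Literature.Probability.LatticeModels.hexGraph Literature.Probability.LatticeModels.hexCenter D a b ∧ ∀ᶠ δ : ℝ in nhdsWithin (0 : ℝ) (Set.Ioi 0), (∃ u : Literature.Probability.LatticeModels.HexVertex, Literature.Probability.LatticeModels.hexGraph.Adj (a δ) u ∧ ((δ : ℂ) * Literature.Probability.LatticeModels.hexCenter u).im ≤ (D.pt 0).im) ∧ (∃ u : Literature.Probability.LatticeModels.HexVertex,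 Literature.Probability.LatticeModels.hexGraph.Adj (b δ) u ∧ ((δ : ℂ) * Literature.Probability.LatticeModels.hexCenter u).im ≤ (D.pt 1).im)) → Literature.Probability.RandomPlanarGeometry.ConvergesInLawToSLE ((8 : NNReal) / 3) D (fun δ (γ : Literature.Probability.RandomPlanarGeometry.SAW.HexDomainSAW D.carrier δ (a δ) (b δ)) => γ.curve) (fun δ => Literature.Probability.RandomPlanarGeometry.SAW.hexSAWLaw D.carrier δ (a δ) (b δ))

/-- STATEMENT 5 — `BoundaryUniversality` (E) (child 4 of the split, verbatim; necessary, `boundaryUniversality_of_hexConjecture`). -/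
def BoundaryUniversality : Prop :=
  (∀ (D : Literature.Probability.RandomPlanarGeometry.DobrushinDomain) (ρ : ℝ) (a b : ℝ → Literature.Probability.LatticeModels.HexVertex), (0 < ρ ∧ (D.pt 1).im = (D.pt 0).im ∧ D.carrier ⊆ {z : ℂ | (D.pt 0).im < z.im} ∧ D.carrier ∩ Metric.ball (D.pt 0) ρ = {z : ℂ | (D.pt 0).im < z.im} ∩ Metric.ball (D.pt 0) ρ ∧ D.carrier ∩ Metric.ball (D.pt 1) ρ = {z : ℂ | (D.pt 1).im < z.im} ∩ Metric.ball (D.pt 1) ρ) → (Literature.Probability.RandomPlanarGeometry.SAW.IsEmbEndpointApprox Literature.Probability.LatticeModels.hexGraph Literature.Probability.LatticeModels.hexCenter D a b ∧ ∀ᶠ δ : ℝ in nhdsWithin (0 : ℝ) (Set.Ioi 0), (∃ u : Literature.Probability.LatticeModels.HexVertex, Literature.Probability.LatticeModels.hexGraph.Adj (a δ) u ∧ ((δ : ℂ) * Literature.Probability.LatticeModels.hexCenter u).im ≤ (D.pt 0).im) ∧ (∃ u : Literature.Probability.LatticeModels.HexVertex, Literature.Probability.LatticeModels.hexGraph.Adj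 (b δ) u ∧ ((δ : ℂ) * Literature.Probability.LatticeModels.hexCenter u).im ≤ (D.pt 1).im)) → Literature.Probability.RandomPlanarGeometry.ConvergesInLawToSLE ((8 : NNReal) / 3) D (fun δ (γ : Literature.Probability.RandomPlanarGeometry.SAW.HexDomainSAW D.carrier δ (a δ) (b δ)) => γ.curve) (fun δ => Literature.Probability.RandomPlanarGeometry.SAW.hexSAWLaw D.carrier δ (a δ) (b δ))) → ∀ (D : Literature.Probability.RandomPlanarGeometry.DobrushinDomain) (a b : ℝ → Literature.Probability.LatticeModels.HexVertex), Literature.Probability.RandomPlanarGeometry.SAW.IsEmbEndpointApprox Literature.Probability.LatticeModels.hexGraph Literature.Probability.LatticeModels.hexCenter D a b → Literature.Probability.RandomPlanarGeometry.ConvergesInLawToSLE ((8 : NNReal) / 3) D (fun δ (γ : Literature.Probability.RandomPlanarGeometry.SAW.HexDomainSAW D.carrier δ (a δ) (b δ)) => γ.curve) (fun δ => Literature.Probability.RandomPlanarGeometry.SAW.hexSAWLaw D.carrier δ (a δ) (b δ))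

/-- (E) is `FloorConvergence → crux` on the nose. -/
theorem boundaryUniversality_iff : BoundaryUniversality ↔ (FloorConvergence →
    Summit.CriticalPhenomena.SAWScalingLimit.Theses.SAWDevelopingMap.HexConjecture) := Iff.rfl

/-! ## Registered stubs (`sorry` only here) -/

/-- STUB 1 (shared; XL; = child `FloorRatioLimit`; closes the day stmt-14003 lands). -/
theorem stub_floorRatioLimit : ∀ (D D' : Literature.Probability.RandomPlanarGeometry.DobrushinDomain) (ρ : ℝ) (Λ : ℝ → Finset Literature.Probability.LatticeModels.HexVertex) (m₀ m m' : ℝ → ℤ) (a b b' : ℝ → Sym2 Literature.Probability.LatticeModels.HexVertex) (Φ : Literature.Probability.RandomPlanarGeometry.ConformalEquiv D.carrier UpperHalfPlane.upperHalfPlaneSet) (L : ℂ → ℂ) (Lb Lb' : ℂ), D'.carrier = D.carrier → D'.pt 0 = D.pt 0 → 0 < ρ → D.carrier ∩ Metric.ball (D.pt 0) ρ = {z : ℂ | (D.pt 0).im < z.im} ∩ Metric.ball (D.pt 0) ρ → D.carrier ∩ Metric.ball (D.pt 1) ρ = {z : ℂ | (D.pt 1).im < z.im} ∩ Metric.ball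 (D.pt 1) ρ → D.carrier ∩ Metric.ball (D'.pt 1) ρ = {z : ℂ | (D'.pt 1).im < z.im} ∩ Metric.ball (D'.pt 1) ρ → (∀ᶠ δ : ℝ in nhdsWithin (0 : ℝ) (Set.Ioi 0), Literature.Probability.RandomPlanarGeometry.SAW.hexDomainSimplyConnected (Λ δ) ∧ a δ ∈ Literature.Probability.RandomPlanarGeometry.SAW.hexDomainBoundary (Λ δ) ∧ b δ ∈ Literature.Probability.RandomPlanarGeometry.SAW.hexDomainBoundary (Λ δ) ∧ b' δ ∈ Literature.Probability.RandomPlanarGeometry.SAW.hexDomainBoundary (Λ δ) ∧ Nonempty (Literature.Probability.RandomPlanarGeometry.SAW.HexMidEdgeSAW (Λ δ) (a δ) (b δ)) ∧ Nonempty (Literature.Probability.RandomPlanarGeometry.SAW.HexMidEdgeSAW (Λ δ) (a δ) (b' δ)) ∧ (Literature.Probability.LatticeModels.hexGraph.induce (↑(Λ δ) : Set Literature.Probability.LatticeModels.HexVertex)).Preconnected ∧ (∀ v ∈ Λ δ, (δ : ℂ) * Literature.Probability.LatticeModels.hexCenter v ∈ D.carrier) ∧ (∀ v : Literature.Probability.LatticeModels.HexVertex,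 (δ : ℂ) * Literature.Probability.LatticeModels.hexCenter v ∈ Metric.ball (D.pt 0) ρ → (v ∈ Λ δ ↔ m₀ δ ≤ v.1 1)) ∧ (∀ v : Literature.Probability.LatticeModels.HexVertex, (δ : ℂ) * Literature.Probability.LatticeModels.hexCenter v ∈ Metric.ball (D.pt 1) ρ → (v ∈ Λ δ ↔ m δ ≤ v.1 1)) ∧ (∀ v : Literature.Probability.LatticeModels.HexVertex, (δ : ℂ) * Literature.Probability.LatticeModels.hexCenter v ∈ Metric.ball (D'.pt 1) ρ → (v ∈ Λ δ ↔ m' δ ≤ v.1 1))) → (∀ K : Set ℂ, IsCompact K → K ⊆ D.carrier → ∀ᶠ δ : ℝ in nhdsWithin (0 : ℝ) (Set.Ioi 0), ∀ v : Literature.Probability.LatticeModels.HexVertex, (δ : ℂ) * Literature.Probability.LatticeModels.hexCenter v ∈ K → v ∈ Λ δ) → Filter.Tendsto (fun δ : ℝ => (δ : ℂ) * Literature.Probability.RandomPlanarGeometry.SAW.hexMidpoint (a δ)) (nhdsWithin (0 : ℝ) (Set.Ioi 0)) (nhds (D.pt 0)) → Filter.Tendsto (fun δ : ℝ => (δ :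 ℂ) * Literature.Probability.RandomPlanarGeometry.SAW.hexMidpoint (b δ)) (nhdsWithin (0 : ℝ) (Set.Ioi 0)) (nhds (D.pt 1)) → Filter.Tendsto (fun δ : ℝ => (δ : ℂ) * Literature.Probability.RandomPlanarGeometry.SAW.hexMidpoint (b' δ)) (nhdsWithin (0 : ℝ) (Set.Ioi 0)) (nhds (D'.pt 1)) → Filter.Tendsto (fun x => ‖Φ x‖) (nhdsWithin (D.pt 0) D.carrier) Filter.atTop → Φ.HasBoundaryValue (D.pt 1) 0 → ContinuousOn L D.carrier → (∀ z ∈ D.carrier, Complex.exp (L z) = deriv Φ z) → Filter.Tendsto L (nhdsWithin (D.pt 1) D.carrier) (nhds Lb) → Filter.Tendsto L (nhdsWithin (D'.pt 1) D.carrier) (nhds Lb') → Filter.Tendsto (fun δ : ℝ => ‖Literature.Probability.RandomPlanarGeometry.SAW.hexParafermionicObservable (Λ δ) (a δ) Literature.Probability.RandomPlanarGeometry.SAW.hexCriticalFugacity (5 / 8) (b' δ) / Literature.Probability.RandomPlanarGeometry.SAW.hexParafermionicObservable (Λ δ) (a δ) Literature.Probability.RandomPlanarGeometry.SAW.hexCriticalFugacity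 (5 / 8) (b δ)‖) (nhdsWithin (0 : ℝ) (Set.Ioi 0)) (nhds (Real.exp ((5 / 8) * (Lb' - Lb).re))) := by
  sorry

/-- STUB 2 (THE NEW LEVER; L–XL; observable-side): `SideFloorComparison`. -/
theorem stub_sideFloorComparison : ∃ C : ℝ, ∃ L₀ : ℕ, ∀ L : ℕ, L₀ ≤ L → Literature.Probability.RandomPlanarGeometry.SAW.HV.triDl L ≤ C * ∑ d ∈ Finset.Icc ((L : ℤ) / 4) ((L : ℤ) / 2), ∑ P ∈ (Literature.Probability.RandomPlanarGeometry.SAW.HV.midWalks (Literature.Probability.RandomPlanarGeometry.SAW.HV.triV L)).filter (fun P => Literature.Probability.RandomPlanarGeometry.SAW.HV.finalDart P = ((d, 0, false), (d, -1, true)) ∨ Literature.Probability.RandomPlanarGeometry.SAW.HV.finalDart P = ((d, -1, true), (d, 0, false))), Literature.Probability.RandomPlanarGeometry.SAW.hexCriticalFugacity ^ Literature.Probability.RandomPlanarGeometry.SAW.HV.mwLen P := by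
  sorry

/-- STUB 3 (GLUE; M; monotonicity `T_{⌊R/4⌋} ⊆ B_R(x)` + the chart of the lead's `…TriangleChart` / `…WindowMassCube` files + window
arithmetic `[L/4, L/2] ⊆ [R/20, R/8]`): `SideFloorComparison → WindowTwoPointLowerBound`. -/
theorem stub_windowTwoPoint_of_sideFloorComparison : (∃ C : ℝ, ∃ L₀ : ℕ, ∀ L : ℕ, L₀ ≤ L → Literature.Probability.RandomPlanarGeometry.SAW.HV.triDl L ≤ C * ∑ d ∈ Finset.Icc ((L : ℤ) / 4) ((L : ℤ) / 2), ∑ P ∈ (Literature.Probability.RandomPlanarGeometry.SAW.HV.midWalks (Literature.Probability.RandomPlanarGeometry.SAW.HV.triV L)).filter (fun P => Literature.Probability.RandomPlanarGeometry.SAW.HV.finalDart P = ((d, 0, false), (d, -1, true)) ∨ Literature.Probability.RandomPlanarGeometry.SAW.HV.finalDart P = ((d, -1, true), (d, 0, false))), Literature.Probability.RandomPlanarGeometry.SAW.hexCriticalFugacity ^ Literature.Probability.RandomPlanarGeometry.SAW.HV.mwLen P) → (∃ θa θb C : ℝ, 0 < θa ∧ θa < θb ∧ θb ≤ 1 / 4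 ∧ 0 < C ∧ ∃ R₀ : ℝ, 0 < R₀ ∧ ∀ R : ℝ, R₀ ≤ R → ∀ (x : Literature.Probability.LatticeModels.Site 2) (B : Finset Literature.Probability.LatticeModels.HexVertex) (S' : Finset ℤ), (∀ v : Literature.Probability.LatticeModels.HexVertex, v ∈ B ↔ (x 1 ≤ v.1 1 ∧ dist (Literature.Probability.LatticeModels.hexCenter v) (Literature.Probability.RandomPlanarGeometry.SAW.hexMidpoint s((x - Pi.single 1 1, 1), (x, 0))) ≤ R)) → (∀ d : ℤ, d ∈ S' ↔ (θa * R ≤ (d : ℝ) ∧ (d : ℝ) ≤ θb * R)) → Literature.Probability.RandomPlanarGeometry.SAW.HV.triDl ⌊R / 4⌋₊ ≤ C * ∑ d ∈ S', ∑ γ : Literature.Probability.RandomPlanarGeometry.SAW.HexMidEdgeSAW B s((x - Pi.single 1 1, 1), (x, 0)) s((x + Pi.single 0 d - Pi.single 1 1, 1), (x + Pi.single 0 d, 0)), Literature.Probability.RandomPlanarGeometry.SAW.hexCriticalFugacity ^ γ.length) := by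
  sorry

/-- STUB 4 (shared; XL; = child `UniformModulus`). -/
theorem stub_uniformModulus : ∀ (D : Literature.Probability.RandomPlanarGeometry.DobrushinDomain) (ρ : ℝ) (a b : ℝ → Literature.Probability.LatticeModels.HexVertex), (0 < ρ ∧ (D.pt 1).im = (D.pt 0).im ∧ D.carrier ⊆ {z : ℂ | (D.pt 0).im < z.im} ∧ D.carrier ∩ Metric.ball (D.pt 0) ρ = {z : ℂ | (D.pt 0).im < z.im} ∩ Metric.ball (D.pt 0) ρ ∧ D.carrier ∩ Metric.ball (D.pt 1) ρ = {z : ℂ | (D.pt 1).im < z.im} ∩ Metric.ball (D.pt 1) ρ) → (Literature.Probability.RandomPlanarGeometry.SAW.IsEmbEndpointApprox Literature.Probability.LatticeModels.hexGraph Literature.Probability.LatticeModels.hexCenter D a b ∧ ∀ᶠ δ : ℝ in nhdsWithin (0 : ℝ) (Set.Ioi 0), (∃ u : Literature.Probability.LatticeModels.HexVertex, Literature.Probability.LatticeModels.hexGraph.Adj (a δ) u ∧ ((δ : ℂ) * Literature.Probability.LatticeModels.hexCenter u).im ≤ (D.pt 0).im) ∧ (∃ u : Literature.Probability.LatticeModels.HexVertex,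 Literature.Probability.LatticeModels.hexGraph.Adj (b δ) u ∧ ((δ : ℂ) * Literature.Probability.LatticeModels.hexCenter u).im ≤ (D.pt 1).im)) → ∀ ε η : ℝ, 0 < ε → 0 < η → ∃ θ : ℝ, 0 < θ ∧ ∀ᶠ δ : ℝ in nhdsWithin (0 : ℝ) (Set.Ioi 0), Literature.Probability.RandomPlanarGeometry.SAW.hexSAWLaw D.carrier δ (a δ) (b δ) {γ | γ.curve ∉ Literature.Probability.RandomPlanarGeometry.CurveClass.modulusClass ε θ} ≤ ENNReal.ofReal η := by
  sorry

/-- STUB 5 (shared; XL; = child `BoundaryUniversality`). -/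
theorem stub_boundaryUniversality : (∀ (D : Literature.Probability.RandomPlanarGeometry.DobrushinDomain) (ρ : ℝ) (a b : ℝ → Literature.Probability.LatticeModels.HexVertex), (0 < ρ ∧ (D.pt 1).im = (D.pt 0).im ∧ D.carrier ⊆ {z : ℂ | (D.pt 0).im < z.im} ∧ D.carrier ∩ Metric.ball (D.pt 0) ρ = {z : ℂ | (D.pt 0).im < z.im} ∩ Metric.ball (D.pt 0) ρ ∧ D.carrier ∩ Metric.ball (D.pt 1) ρ = {z : ℂ | (D.pt 1).im < z.im} ∩ Metric.ball (D.pt 1) ρ) → (Literature.Probability.RandomPlanarGeometry.SAW.IsEmbEndpointApprox Literature.Probability.LatticeModels.hexGraph Literature.Probability.LatticeModels.hexCenter D a b ∧ ∀ᶠ δ : ℝ in nhdsWithin (0 : ℝ) (Set.Ioi 0), (∃ u : Literature.Probability.LatticeModels.HexVertex, Literature.Probability.LatticeModels.hexGraph.Adj (a δ) u ∧ ((δ : ℂ) * Literature.Probability.LatticeModels.hexCenter u).im ≤ (D.pt 0).im) ∧ (∃ u : Literature.Probability.LatticeModels.HexVertex, Literature.Probability.LatticeModels.hexGraph.Adj (b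 δ) u ∧ ((δ : ℂ) * Literature.Probability.LatticeModels.hexCenter u).im ≤ (D.pt 1).im)) → Literature.Probability.RandomPlanarGeometry.ConvergesInLawToSLE ((8 : NNReal) / 3) D (fun δ (γ : Literature.Probability.RandomPlanarGeometry.SAW.HexDomainSAW D.carrier δ (a δ) (b δ)) => γ.curve) (fun δ => Literature.Probability.RandomPlanarGeometry.SAW.hexSAWLaw D.carrier δ (a δ) (b δ))) → ∀ (D : Literature.Probability.RandomPlanarGeometry.DobrushinDomain) (a b : ℝ → Literature.Probability.LatticeModels.HexVertex), Literature.Probability.RandomPlanarGeometry.SAW.IsEmbEndpointApprox Literature.Probability.LatticeModels.hexGraph Literature.Probability.LatticeModels.hexCenter D a b → Literature.Probability.RandomPlanarGeometry.ConvergesInLawToSLE ((8 : NNReal) / 3) D (fun δ (γ : Literature.Probability.RandomPlanarGeometry.SAW.HexDomainSAW D.carrier δ (a δ) (b δ)) => γ.curve) (fun δ => Literature.Probability.RandomPlanarGeometry.SAW.hexSAWLaw D.carrier δ (a δ) (b δ)) := by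
  sorry

/-! ## Glue (sorry-free) -/

/-- Floor-vertex endpoints are discrete-boundary endpoints, eventually, on floor domains (the endpoint passage of the landed
`Split.stub_discreteBoundary_of_floorVertex`, p142668, reproduced here because the check farm has not yet built that module). [folklore] -/
theorem discreteBoundary_of_floorVertex : ∀ {D : DobrushinDomain} {a b : ℝ → HexVertex},
    D.carrier ⊆ {z : ℂ | (D.pt 0).im < z.im} → (D.pt 1).im = (D.pt 0).im →
    IsEmbEndpointApprox hexGraph hexCenter D a b →
    (∀ᶠ δ : ℝ in 𝓝[>] 0, (∃ u : HexVertex, hexGraph.Adj (a δ) u ∧ ((δ : ℂ) * hexCenter u).im ≤ (D.pt 0).im) ∧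
      (∃ u : HexVertex, hexGraph.Adj (b δ) u ∧ ((δ : ℂ) * hexCenter u).im ≤ (D.pt 1).im)) →
    ∀ᶠ δ : ℝ in 𝓝[>] 0,
      (a δ ∈ embMeshDomain hexGraph hexCenter D.carrier δ ∧ ∃ w, hexGraph.Adj (a δ) w ∧ ¬ (hexDomainGraph D.carrier δ).Adj (a δ) w) ∧
      (b δ ∈ embMeshDomain hexGraph hexCenter D.carrier δ ∧ ∃ w, hexGraph.Adj (b δ) w ∧ ¬ (hexDomainGraph D.carrier δ).Adj (b δ) w) := by
  intro D a b hD h01 hab hfl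
  have hbelow : ∀ {δ : ℝ} {v u : HexVertex}, ((δ : ℂ) * hexCenter u).im ≤ (D.pt 0).im →
      ¬ (hexDomainGraph D.carrier δ).Adj v u := by
    intro δ v u hu hadj
    have huΩ : u ∈ embMeshDomain hexGraph hexCenter D.carrier δ := ((embDomainGraph_adj_iff _ _).1 hadj).2.2
    have : (D.pt 0).im < ((δ : ℂ) * hexCenter u).im := hD (embMeshDomain_subset _ _ _ _ huΩ)
    exact absurd this (not_lt.2 hu)
  have hmem : ∀ {δ : ℝ} {u v : HexVertex}, u ≠ v → (hexDomainGraph D.carrier δ).Reachable u v →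
      u ∈ embMeshDomain hexGraph hexCenter D.carrier δ := by
    intro δ u v huv h
    obtain ⟨p⟩ := h
    cases p with
    | nil => exact absurd rfl huv
    | cons hadj _ => exact ((embDomainGraph_adj_iff _ _).1 hadj).2.1
  filter_upwards [hfl, hab.reachable,
    Summit.CriticalPhenomena.SAWScalingLimit.Cruxes.HexConjecture.NonVacuity.IsEmbEndpointApprox.eventually_ne hab]
    with δ hδ hreach hne
  obtain ⟨⟨u, hu, hui⟩, ⟨u', hu', hui'⟩⟩ := hδ
  rw [h01] at hui'
  exact ⟨⟨hmem hne hreach, u, hu, hbelow hui⟩, ⟨hmem (Ne.symm hne) hreach.symm, u', hu', hbelow hui'⟩⟩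

/-- Layer 1 (= the landed `Split.HexConjecture_of_subs`, re-derived from its two built imports): FRL → WTLB → UIM → (E) → crux.
Kept so that ANY proof of WTLB (T-side REG/doubling of the live line, or SFB of this line) closes this skeleton. -/
theorem HexConjecture_of_windowTwoPoint (hF : FloorRatioLimit) (hW : WindowTwoPointLowerBound) (hU : UniformModulus)
    (hE : BoundaryUniversality) : Summit.CriticalPhenomena.SAWScalingLimit.Theses.SAWDevelopingMap.HexConjecture := by
  refine boundaryUniversality_iff.1 hE ?_
  intro D ρ a b hfl hend
  exact Summit.CriticalPhenomena.SAWScalingLimit.Theorems.HexConjecture.RootLocality.hexConjectureFloor_of_aspectEstimates hF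
    (Summit.CriticalPhenomena.SAWScalingLimit.Theorems.HexConjecture.RootLocality.archAspectBound_of_windowTwoPointLowerBound hW)
    hU D ρ a b hfl hend.1 (discreteBoundary_of_floorVertex hfl.2.2.1 hfl.2.1 hend.1 hend.2)

/-- **The crux from the five statements of this line** (kernel-checked; conclusion = the route decl BY NAME):
floor-ratio limit → side/floor comparison → (its monotonicity glue) → uniform modulus → boundary universality →
`SAWDevelopingMap.HexConjecture`. -/
theorem HexConjecture_of (hF : FloorRatioLimit) (hS : SideFloorComparison)
    (hSW : SideFloorComparison → WindowTwoPointLowerBound) (hU : UniformModulus) (hE : BoundaryUniversality) :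
    Summit.CriticalPhenomena.SAWScalingLimit.Theses.SAWDevelopingMap.HexConjecture :=
  HexConjecture_of_windowTwoPoint hF (hSW hS) hU hE

/-- The crux BY NAME from the registered stubs of this line. -/
theorem HexConjecture_proof : Summit.CriticalPhenomena.SAWScalingLimit.Theses.SAWDevelopingMap.HexConjecture :=
  HexConjecture_of stub_floorRatioLimit stub_sideFloorComparison stub_windowTwoPoint_of_sideFloorComparison
    stub_uniformModulus stub_boundaryUniversality

/-- Same statement for the `SAWHexUniversality` decl (the lead's registered `crux_decl`; identical body). -/
theorem HexConjecture_of' (hF : FloorRatioLimit) (hS : SideFloorComparison)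
    (hSW : SideFloorComparison → WindowTwoPointLowerBound) (hU : UniformModulus) (hE : BoundaryUniversality) :
    Summit.CriticalPhenomena.SAWScalingLimit.Theses.SAWHexUniversality.HexConjecture :=
  HexConjecture_of hF hS hSW hU hE

/-- Same statement for the `SAWBrickWallHomotopy` decl (rank-2 load-bearing crux there; identical body). -/
theorem HexConjecture_of'' (hF : FloorRatioLimit) (hS : SideFloorComparison)
    (hSW : SideFloorComparison → WindowTwoPointLowerBound) (hU : UniformModulus) (hE : BoundaryUniversality) :
    Summit.CriticalPhenomena.SAWScalingLimit.Theses.SAWBrickWallHomotopy.HexConjecture :=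
  HexConjecture_of hF hS hSW hU hE

theorem HexConjecture_proof' : Summit.CriticalPhenomena.SAWScalingLimit.Theses.SAWHexUniversality.HexConjecture :=
  HexConjecture_proof

theorem HexConjecture_proof'' : Summit.CriticalPhenomena.SAWScalingLimit.Theses.SAWBrickWallHomotopy.HexConjecture :=
  HexConjecture_proof

end Summit.CriticalPhenomena.SAWScalingLimit.Cruxes.HexConjecture.OneDomainSideFloorProfile

end
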